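import Summits.HodgeConjecture.HodgeConjecture.Theses.GenericDivisibility
import Literature.AlgebraicGeometry.HodgeTheory.ComplexConjugationHolds

/-!
# Route GenericDivisibility — `HodgeModelsExist` (item stmt-HodgeConjecture-18143)

The support item `HodgeModelsExist` of route `GenericDivisibility` —
`∀ n X, IsSmoothProjective n X → Nonempty (HodgeModel n X)`, i.e. `∀ n X, nonempty_hodgeModel n X`
unfolded (every smooth projective complex variety of dimension `n` has a Hodge model: Serre's
analytification `X^an`, a natural complex de Rham comparison, and the Hodge decomposition of the
compact Kähler manifold `X^an ⊂ ℙᴺ(ℂ)`) — is the hypothesis `hM` of this route's deciding theorem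
`closes` (the anti-vacuity conjunct of `HodgeConjectureFor` in the dimension induction).  The
Literature named fact `nonempty_hodgeModel n X` is discharged in tree by
`Literature.AlgebraicGeometry.HodgeTheory.nonempty_hodgeModel_holds`
(`HodgeTheory/ComplexConjugationHolds`, resting on `Motives.isInternal_hodgePQ_holds` and nothing
unproved), so the item closes in one line, exactly as its docstring prescribes.  Self-contained: it
imports only this route's thesis file plus the discharge (the route file deliberately does not
import `ComplexConjugationHolds`, to keep its import cone small).
-/

-- `Summit.HodgeConjecture.HodgeConjecture.Theorems` is the mandated namespace (single-problem summit:
-- Problem = Summit), which `linter.dupNamespace` flags on every declaration; the lakefile turns the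
-- linter off tree-wide (weak option), restated here so stand-alone elaboration is warning-free too.
set_option linter.dupNamespace false

noncomputable section

namespace Summit.HodgeConjecture.HodgeConjecture.Theorems

/-- **Item stmt-HodgeConjecture-18143 (`HodgeModelsExist`), route `GenericDivisibility`**: for every
`n` and every `X : SchemeOver ℂ`, if `X` is smooth projective of dimension `n` then
`Nonempty (HodgeModel n X)` — by the Literature discharge `nonempty_hodgeModel_holds`
(Serre GAGA §2 n°5 Prop. 2: analytification; de Rham's theorem; Voisin (2002) §3.3.2 and §6.1.3
Prop. 6.11: `X^an` is compact Kähler and carries the Hodge decomposition).  The type is literally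
the route decl `Summit.HodgeConjecture.HodgeConjecture.Theses.GenericDivisibility.HodgeModelsExist`.
[cite: SerreGAGA1956, §2 n°5 Prop. 2 and n°7 Prop. 6]
[cite: VoisinHodgeI2002, §3.3.2 and §6.1.3 Prop. 6.11] -/
theorem genericDivisibility_hodgeModelsExist_proof :
    Summit.HodgeConjecture.HodgeConjecture.Theses.GenericDivisibility.HodgeModelsExist := by
  unfold Summit.HodgeConjecture.HodgeConjecture.Theses.GenericDivisibility.HodgeModelsExist
  intro n X hX
  exact Literature.AlgebraicGeometry.HodgeTheory.nonempty_hodgeModel_holds hX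

end Summit.HodgeConjecture.HodgeConjecture.Theorems

end
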